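import Literature.Computability.AlgebraicComplexity.BLMW11KroneckerApproximation
import Literature.Computability.AlgebraicComplexity.HomogeneousComponentsComplexity
import Literature.Computability.AlgebraicComplexity.IMMInVPProofs
import Literature.Computability.AlgebraicComplexity.ArithCircuitProofs
import HarnessLib

/-!
# Approximate complexity under projections, renamings and truncation (Bürgisser 2004 §2, §4;
# BLMW 2011 §9.3) — proofs against the tree's rendering of `\underline{L}`

The tree renders BLMW 2011 Def. 9.3.1 as
`approxComplexity f = sInf {r | coeffVec f ∈ zariskiClosure (coeffVec '' {g | complexity g ≤ r})}`,
the Zariski closure being taken in the FULL coefficient space `(σ →₀ ℕ) → ℂ` (test polynomials in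
finitely many coefficient coordinates; the approximants `g` have unbounded degree). In that space a
substitution of NONZERO constants is not Zariski-continuous (one coefficient of `F(a)` is an
infinite sum of coefficients of `F`), which is why the summit-side files so far only had
"`\overline{VP}` is closed under p-projections from FORMS"
(`…NaturalProofsSeparateVNPHamiltonian`, `isVPBarFamily_of_isPProjection_of_isHomogeneous`).
This file proves the general statements:

* `coeffVec_mem_zariskiClosure_of_rowFinite` — a linear map `Ψ` on polynomials whose matrix in the
  monomial bases is ROW-FINITE (each coefficient of `Ψ P` depends on finitely many coefficients of
  `P`) is Zariski-continuous on coefficient vectors: `coeff P ∈ \overline{coeff S}` and `Ψ S ⊆ T`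
  give `coeff (Ψ P) ∈ \overline{coeff T}` (pull the test polynomial back along the finite rows).
  Row-finite are: every map sending monomials to forms of the same degree
  (`rowFinite_of_monomial_isHomogeneous`: substitutions of degree-one forms — renamings,
  killing variables, the `GL`/`End` action), and `Φ ∘ (truncation to degree ≤ d)` for ANY linear
  `Φ` (`rowFinite_comp_truncation`).
* `approxComplexity_aeval_le_of_isHomogeneous_one` — `\underline{L}(F(ℓ)) ≤ \underline{L}(F) + Σ L(ℓ_i)`
  for degree-one forms `ℓ_i`; `approxComplexity_rename_le`, **`approxComplexity_rename_eq_of_injective`**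
  (`\underline{L}` is invariant under injective renaming / padding of the variable set).
* `coeffVec_mem_zariskiClosure_truncated` — the bridge to Bürgisser's degree-filtered topology
  (Bürgisser 2004 Thm. 2.2, Alder): a polynomial of degree `≤ d` with `\underline{L} = r` lies in the
  closure of the size-`((d+2)² r + (d+1))` polynomials OF DEGREE `≤ d` (truncation is row-finite and
  costs `(d+2)² L + (d+1)`, BCS 1997 Lemma (21.25) = the tree's `complexity_sum_homogeneousComponent_le`).
* **`approxComplexity_aeval_le`** — for `deg F ≤ d` and ANY substitution `a`:
  `\underline{L}(F(a)) ≤ (d+2)² · \underline{L}(F) + (d+1) + Σ L(a_i)`; for a Valiant projection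
  (`approxComplexity_le_of_isProjection`) the last sum vanishes.
* **`IsVPBarFamily.of_isPProjection`** — Bürgisser 2004 §4: "if `f` is a projection of `g` then
  `\underline{L}(f) ≤ \underline{L}(g)`; therefore `\underline{VP}` is closed under p-projections" — here for
  the tree's `IsVPBarFamily` (BLMW's `\overline{VP}`) and source families of p-bounded degree (the
  degree hypothesis is part of Bürgisser's "p-family"; the tree's `IsVPBarFamily` carries no degree
  bound, and the inequality of the tree's rendering holds up to the truncation factor `(deg+2)²`).

WHAT THIS IS NOT: nothing here bears on `VP` vs `\overline{VP}` vs `VNP` (Bürgisser 2004 Problem 4.1,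
BLMW 2011 §9.3 are open); these are the elementary closure properties of the definition.

References: [Burgisser2004Factors] §2 (Def. of `\underline{L}`, Thm. 2.2), §4 (Def. of `\underline{VP}`,
"closed under p-projections"); [BurgisserEtAl2011] Def. 9.3.1, §9.3; [BurgisserClausenShokrollahi1997]
Lemma (21.25); [Burgisser2000] Def. 2.1, 2.6, Rem. 2.2, 2.7; Mumford, Red book I §2 (polynomial maps
are Zariski-continuous) [folklore].
-/

noncomputable section

open MvPolynomial

namespace Literature.Computability.AlgebraicComplexity

/-! ### Row-finite linear maps are Zariski-continuous on coefficient space -/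

section RowFinite

variable {k : Type*} [Field k] {σ τ : Type*}

/-- The `μ`-th coefficient of `Ψ P` through the matrix of `Ψ` in the monomial bases:
`coeff_μ (Ψ P) = Σ_{ν ∈ supp P} coeff_μ (Ψ x^ν) · coeff_ν P`. [folklore] -/
private theorem coeff_linearMap_eq_sum_support (Ψ : MvPolynomial σ k →ₗ[k] MvPolynomial τ k)
    (P : MvPolynomial σ k) (μ : τ →₀ ℕ) :
    coeff μ (Ψ P) = ∑ ν ∈ P.support, coeff μ (Ψ (monomial ν 1)) * coeff ν P := by
  conv_lhs => rw [← support_sum_monomial_coeff P]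
  rw [map_sum, coeff_sum]
  refine Finset.sum_congr rfl fun ν _ => ?_
  rw [show monomial ν (coeff ν P) = coeff ν P • monomial ν (1 : k) by
    rw [smul_monomial, smul_eq_mul, mul_one], map_smul, coeff_smul, smul_eq_mul, mul_comm]

/-- If the `μ`-th row of the matrix of `Ψ` is supported in the finite set `W`, then
`coeff_μ (Ψ P) = Σ_{ν ∈ W} coeff_μ (Ψ x^ν) · coeff_ν P` for every `P`. [folklore] -/
private theorem coeff_linearMap_eq_sum_of_subset [DecidableEq σ]
    (Ψ : MvPolynomial σ k →ₗ[k] MvPolynomial τ k)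
    (P : MvPolynomial σ k) (μ : τ →₀ ℕ) {W : Finset (σ →₀ ℕ)}
    (hW : ∀ ν, coeff μ (Ψ (monomial ν 1)) ≠ 0 → ν ∈ W) :
    coeff μ (Ψ P) = ∑ ν ∈ W, coeff μ (Ψ (monomial ν 1)) * coeff ν P := by
  rw [coeff_linearMap_eq_sum_support]
  have h1 : ∑ ν ∈ P.support, coeff μ (Ψ (monomial ν 1)) * coeff ν P =
      ∑ ν ∈ P.support ∪ W, coeff μ (Ψ (monomial ν 1)) * coeff ν P :=
    Finset.sum_subset Finset.subset_union_left fun ν _ hν => by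
      rw [notMem_support_iff.mp hν, mul_zero]
  have h2 : ∑ ν ∈ W, coeff μ (Ψ (monomial ν 1)) * coeff ν P =
      ∑ ν ∈ P.support ∪ W, coeff μ (Ψ (monomial ν 1)) * coeff ν P :=
    Finset.sum_subset Finset.subset_union_right fun ν _ hν => by
      rw [not_not.mp (mt (hW ν) hν), zero_mul]
  rw [h1, h2]

/-- **Pull-back of a coefficient-space polynomial along a row-finite linear map.** With the
`μ`-th row of `Ψ` supported in `W μ`, the polynomial `Q = q(… Σ_{ν ∈ W μ} coeff_μ(Ψ x^ν) · X_ν …)`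
in the source coefficient coordinates satisfies `Q(coeff P) = q(coeff (Ψ P))` for every `P`.
[folklore] -/
private theorem aeval_coeffVec_rowFinitePullback [DecidableEq σ]
    (Ψ : MvPolynomial σ k →ₗ[k] MvPolynomial τ k)
    {W : (τ →₀ ℕ) → Finset (σ →₀ ℕ)} (hW : ∀ μ ν, coeff μ (Ψ (monomial ν 1)) ≠ 0 → ν ∈ W μ)
    (q : MvPolynomial (τ →₀ ℕ) k) (P : MvPolynomial σ k) :
    aeval (coeffVec P) (bind₁ (fun μ => ∑ ν ∈ W μ, C (coeff μ (Ψ (monomial ν 1))) * X ν) q) =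
      aeval (coeffVec (Ψ P)) q := by
  rw [aeval_bind₁]
  have key : (fun μ => aeval (coeffVec P) (∑ ν ∈ W μ, C (coeff μ (Ψ (monomial ν 1))) * X ν)) =
      coeffVec (Ψ P) := by
    funext μ
    rw [map_sum, coeffVec_apply, coeff_linearMap_eq_sum_of_subset Ψ P μ (hW μ)]
    refine Finset.sum_congr rfl fun ν _ => ?_
    rw [map_mul, aeval_C, aeval_X, coeffVec_apply, Algebra.algebraMap_self_apply]
  rw [key]

/-- **Row-finite linear maps are Zariski-continuous on coefficient vectors.** If every row of the
matrix of `Ψ` (in the monomial bases) is finitely supported, `coeff P` lies in the Zariski closure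
of `coeff(S)` and `Ψ S ⊆ T`, then `coeff (Ψ P)` lies in the Zariski closure of `coeff(T)`: the
pull-back of a test polynomial along the finite rows is again a polynomial in finitely many
coefficient coordinates — the continuity underlying Bürgisser's Zariski topology on `A_n = k[X]`
"as a limit of the Zariski topologies on the finite dimensional subspaces `{f | deg f ≤ d}`" and the
closure description of `\underline{L}`. [cite: Burgisser2004Factors, §2 (topological interpretation; Thm. 2.2)] -/
theorem coeffVec_mem_zariskiClosure_of_rowFinite (Ψ : MvPolynomial σ k →ₗ[k] MvPolynomial τ k)
    (hΨ : ∀ μ : τ →₀ ℕ, {ν : σ →₀ ℕ | coeff μ (Ψ (monomial ν 1)) ≠ 0}.Finite)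
    {S : Set (MvPolynomial σ k)} {T : Set (MvPolynomial τ k)} (hST : ∀ g ∈ S, Ψ g ∈ T)
    {P : MvPolynomial σ k} (hP : coeffVec P ∈ zariskiClosure (coeffVec '' S)) :
    coeffVec (Ψ P) ∈ zariskiClosure (coeffVec '' T) := by
  classical
  have hW : ∀ μ ν, coeff μ (Ψ (monomial ν 1)) ≠ 0 → ν ∈ (hΨ μ).toFinset :=
    fun μ ν h => (hΨ μ).mem_toFinset.mpr h
  rw [mem_zariskiClosure_iff] at hP ⊢
  intro q hq
  have key := hP (bind₁ (fun μ => ∑ ν ∈ (hΨ μ).toFinset,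
    C (coeff μ (Ψ (monomial ν 1))) * X ν) q) ?_
  · rwa [aeval_coeffVec_rowFinitePullback Ψ hW] at key
  · rintro _ ⟨g, hg, rfl⟩
    rw [aeval_coeffVec_rowFinitePullback Ψ hW]
    exact hq _ ⟨_, hST g hg, rfl⟩

/-- **Degree-preserving maps are row-finite**: if `Ψ` sends each monomial `x^ν` to a form of degree
`|ν|` (substitution of degree-one forms: renamings, killing variables, the linear `GL`/`End`
action), then the `μ`-th row of `Ψ` is supported on `{ν : |ν| = |μ|}`, finite for finitely many
variables. [cite: Burgisser2004Factors, §2 (topological interpretation)] -/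
theorem rowFinite_of_monomial_isHomogeneous [Finite σ]
    (Ψ : MvPolynomial σ k →ₗ[k] MvPolynomial τ k)
    (hΨ : ∀ ν : σ →₀ ℕ, (Ψ (monomial ν 1)).IsHomogeneous ν.degree) (μ : τ →₀ ℕ) :
    {ν : σ →₀ ℕ | coeff μ (Ψ (monomial ν 1)) ≠ 0}.Finite := by
  refine (Finsupp.finite_of_degree_le (σ := σ) μ.degree).subset fun ν hν => ?_
  by_contra hne
  exact hν ((hΨ ν).coeff_eq_zero fun h => hne h.ge)

/-- A substitution of degree-one forms sends monomials to forms of the same degree.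
[folklore] -/
private theorem aeval_monomial_isHomogeneous_of_isHomogeneous_one (a : σ → MvPolynomial τ k)
    (ha : ∀ i, (a i).IsHomogeneous 1) (ν : σ →₀ ℕ) :
    (aeval a (monomial ν (1 : k))).IsHomogeneous ν.degree := by
  simpa only [one_mul] using (isHomogeneous_monomial (1 : k) rfl).aeval a ha

/-- **Truncation followed by any linear map is row-finite**: the `μ`-th coefficient of
`Φ(Σ_{i ≤ d} P^{(i)})` only involves the coefficients of `P` of degree `≤ d` (the restriction maps
of Bürgisser's limit topology over the subspaces `{deg ≤ d}`).
[cite: Burgisser2004Factors, §2 (topological interpretation)] -/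
theorem rowFinite_comp_truncation [Finite σ] (Φ : MvPolynomial σ k →ₗ[k] MvPolynomial τ k)
    (d : ℕ) (μ : τ →₀ ℕ) :
    {ν : σ →₀ ℕ | coeff μ ((Φ ∘ₗ ∑ i ∈ Finset.range (d + 1), homogeneousComponent i)
      (monomial ν 1)) ≠ 0}.Finite := by
  refine (Finsupp.finite_of_degree_le (σ := σ) d).subset fun ν hν => ?_
  by_contra hdeg
  apply hν
  have hzero : ∀ i ∈ Finset.range (d + 1), homogeneousComponent i (monomial ν (1 : k)) = 0 := by
    intro i hi
    refine homogeneousComponent_eq_zero' _ _ fun e he => ?_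
    have he' : e = ν := Finset.mem_singleton.mp (support_monomial_subset he)
    subst he'
    have hi' := Finset.mem_range.mp hi
    simp only [Set.mem_setOf_eq, not_le] at hdeg
    omega
  rw [LinearMap.comp_apply, LinearMap.sum_apply, Finset.sum_eq_zero hzero, map_zero, coeff_zero]

end RowFinite

/-! ### Consequences for `\underline{L}` (BLMW 2011 Def. 9.3.1; Bürgisser 2004 §2, §4) -/

section ApproxComplexity

variable {σ τ : Type*}

/-- The infimum defining `\underline{L}(f)` is attained (`r = L(f)` qualifies).
[cite: BurgisserEtAl2011, Def. 9.3.1] -/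
theorem coeffVec_mem_zariskiClosure_approxComplexity (f : MvPolynomial σ ℂ) :
    coeffVec f ∈ zariskiClosure
      (coeffVec '' {g : MvPolynomial σ ℂ | complexity g ≤ approxComplexity f}) :=
  Nat.sInf_mem (s := {r | coeffVec f ∈ zariskiClosure
      (coeffVec '' {g : MvPolynomial σ ℂ | complexity g ≤ r})})
    ⟨complexity f, subset_zariskiClosure _ ⟨f, show complexity f ≤ complexity f from le_rfl, rfl⟩⟩

/-- `\underline{L}(f) ≤ r` as soon as `coeff f` lies in the closure of the size-`r` polynomials.
[cite: BurgisserEtAl2011, Def. 9.3.1] -/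
theorem approxComplexity_le_of_mem {f : MvPolynomial σ ℂ} {r : ℕ}
    (h : coeffVec f ∈ zariskiClosure (coeffVec '' {g : MvPolynomial σ ℂ | complexity g ≤ r})) :
    approxComplexity f ≤ r :=
  Nat.sInf_le h

/-- **Linear substitutions**: for degree-one forms `ℓ_i`,
`\underline{L}(F(ℓ)) ≤ \underline{L}(F) + Σ_i L(ℓ_i)` (the substitution is row-finite, and costs `Σ L(ℓ_i)`
on each approximant, Bürgisser 2000 Rem. 2.7 = the tree's `complexity_aeval_le`).
[cite: Burgisser2004Factors, §4 (closure under projections)] [cite: Burgisser2000, Rem. 2.7] -/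
theorem approxComplexity_aeval_le_of_isHomogeneous_one [Fintype σ] (F : MvPolynomial σ ℂ)
    (a : σ → MvPolynomial τ ℂ) (ha : ∀ i, (a i).IsHomogeneous 1) :
    approxComplexity (aeval a F) ≤ approxComplexity F + ∑ i, complexity (a i) := by
  refine approxComplexity_le_of_mem ?_
  have h := coeffVec_mem_zariskiClosure_of_rowFinite (aeval a).toLinearMap
    (rowFinite_of_monomial_isHomogeneous _
      (fun ν => aeval_monomial_isHomogeneous_of_isHomogeneous_one a ha ν))
    (S := {g : MvPolynomial σ ℂ | complexity g ≤ approxComplexity F})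
    (T := {g : MvPolynomial τ ℂ | complexity g ≤ approxComplexity F + ∑ i, complexity (a i)})
    (fun g hg => ?_) (coeffVec_mem_zariskiClosure_approxComplexity F)
  · simpa only [AlgHom.toLinearMap_apply] using h
  · show complexity (aeval a g) ≤ approxComplexity F + ∑ i, complexity (a i)
    exact (complexity_aeval_le g a).trans (Nat.add_le_add_right hg _)

/-- **Renaming does not increase `\underline{L}`** (rename the approximants; Bürgisser 2000 Rem. 2.2
for `L`). No injectivity needed. [cite: Burgisser2004Factors, §4] [cite: Burgisser2000, Rem. 2.2] -/
theorem approxComplexity_rename_le [Fintype σ] (e : σ → τ) (F : MvPolynomial σ ℂ) :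
    approxComplexity (rename e F) ≤ approxComplexity F := by
  have h := approxComplexity_aeval_le_of_isHomogeneous_one F (fun i => X (e i))
    fun i => isHomogeneous_X ℂ (e i)
  have h0 : ∑ i, complexity ((fun i => X (e i) : σ → MvPolynomial τ ℂ) i) = 0 :=
    Finset.sum_eq_zero fun i _ => complexity_X_holds (e i)
  rw [h0, add_zero] at h
  rw [rename_eq_aeval]
  exact h

/-- **`\underline{L}` is invariant under injective renaming** (padding the variable set, re-indexing):
rename back along the partial inverse, killing the variables outside the image — a substitution of
the degree-one forms `X_i` and `0`, of cost `0`. [cite: Burgisser2004Factors, §4] [cite: Burgisser2000, Rem. 2.2] -/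
theorem approxComplexity_rename_eq_of_injective [Fintype σ] [Fintype τ] {e : σ → τ}
    (he : Function.Injective e) (F : MvPolynomial σ ℂ) :
    approxComplexity (rename e F) = approxComplexity F := by
  classical
  refine le_antisymm (approxComplexity_rename_le e F) ?_
  -- the partial inverse substitution
  set κ : τ → MvPolynomial σ ℂ := fun j => if h : ∃ i, e i = j then X h.choose else 0 with hκ
  have hκe : ∀ i, κ (e i) = X i := by
    intro i
    have h : ∃ i', e i' = e i := ⟨i, rfl⟩
    rw [hκ]
    simp only [dif_pos h]
    rw [he h.choose_spec]
  have hback : aeval κ (rename e F) = F := by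
    rw [aeval_rename, show κ ∘ e = X from funext hκe, aeval_X_left_apply]
  have hhom : ∀ j, (κ j).IsHomogeneous 1 := by
    intro j
    by_cases h : ∃ i, e i = j
    · rw [hκ]; simp only [dif_pos h]; exact isHomogeneous_X ℂ _
    · rw [hκ]; simp only [dif_neg h]; exact isHomogeneous_zero _ _ _
  have hcost : ∑ j, complexity (κ j) = 0 := by
    refine Finset.sum_eq_zero fun j _ => ?_
    by_cases h : ∃ i, e i = j
    · rw [hκ]; simp only [dif_pos h]; exact complexity_X_holds _
    · rw [hκ]; simp only [dif_neg h]; rw [← C_0]; exact complexity_C_holds _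
  have h := approxComplexity_aeval_le_of_isHomogeneous_one (rename e F) κ hhom
  rw [hback, hcost, add_zero] at h
  exact h

/-- Truncation to degree `≤ d` fixes a polynomial of degree `≤ d`. [folklore] -/
private theorem sum_homogeneousComponent_of_totalDegree_le {F : MvPolynomial σ ℂ} {d : ℕ}
    (hF : F.totalDegree ≤ d) :
    ∑ i ∈ Finset.range (d + 1), homogeneousComponent i F = F := by
  conv_rhs => rw [← sum_homogeneousComponent F]
  refine (Finset.sum_subset (fun i hi => ?_) fun i _ hi => ?_).symm
  · have := Finset.mem_range.mp hi
    exact Finset.mem_range.mpr (by omega)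
  · have := Finset.mem_range.not.mp hi
    exact homogeneousComponent_eq_zero _ _ (by omega)

/-- **The bridge to the degree-filtered topology (Bürgisser 2004 Thm. 2.2, Alder 1984).** A
polynomial `F` of degree `≤ d` lies in the Zariski closure of the polynomials of circuit size
`≤ (d+2)² · \underline{L}(F) + (d+1)` AND DEGREE `≤ d`: truncation `P ↦ Σ_{i ≤ d} P^{(i)}` is row-finite,
fixes `F`, and costs `(d+2)² L(P) + (d+1)` (BCS 1997 Lemma (21.25)).
[cite: Burgisser2004Factors, Thm. 2.2] [cite: BurgisserClausenShokrollahi1997, Lemma (21.25)] -/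
theorem coeffVec_mem_zariskiClosure_truncated [Fintype σ] {F : MvPolynomial σ ℂ} {d : ℕ}
    (hF : F.totalDegree ≤ d) :
    coeffVec F ∈ zariskiClosure (coeffVec ''
      {g : MvPolynomial σ ℂ | complexity g ≤ (d + 2) ^ 2 * approxComplexity F + (d + 1) ∧
        g.totalDegree ≤ d}) := by
  have h := coeffVec_mem_zariskiClosure_of_rowFinite
    (LinearMap.id ∘ₗ ∑ i ∈ Finset.range (d + 1),
      (homogeneousComponent i : MvPolynomial σ ℂ →ₗ[ℂ] MvPolynomial σ ℂ))
    (rowFinite_comp_truncation LinearMap.id d)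
    (S := {g : MvPolynomial σ ℂ | complexity g ≤ approxComplexity F})
    (T := {g : MvPolynomial σ ℂ | complexity g ≤ (d + 2) ^ 2 * approxComplexity F + (d + 1) ∧
        g.totalDegree ≤ d})
    (fun g hg => ?_) (coeffVec_mem_zariskiClosure_approxComplexity F)
  · rw [LinearMap.comp_apply, LinearMap.sum_apply, LinearMap.id_apply,
      sum_homogeneousComponent_of_totalDegree_le hF] at h
    exact h
  · rw [LinearMap.comp_apply, LinearMap.sum_apply, LinearMap.id_apply]
    refine ⟨(complexity_sum_homogeneousComponent_le g d).trans
      (Nat.add_le_add_right (Nat.mul_le_mul_left _ hg) _), ?_⟩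
    refine totalDegree_finsetSum_le fun i hi => ?_
    have hi' := Finset.mem_range.mp hi
    exact (homogeneousComponent_isHomogeneous i g).totalDegree_le.trans (by omega)

/-- **Arbitrary substitutions** (constants allowed): for `deg F ≤ d`,
`\underline{L}(F(a)) ≤ (d+2)² · \underline{L}(F) + (d+1) + Σ_i L(a_i)` — substitute into the TRUNCATED
approximants (`P ↦ (Σ_{i ≤ d} P^{(i)})(a)` is row-finite and fixes `F`). The factor `(d+2)²` is the
price of the tree's rendering of `\underline{L}` by approximants of unbounded degree.
[cite: Burgisser2004Factors, §4] [cite: BurgisserClausenShokrollahi1997, Lemma (21.25)] -/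
theorem approxComplexity_aeval_le [Fintype σ] {F : MvPolynomial σ ℂ} {d : ℕ} (hF : F.totalDegree ≤ d)
    (a : σ → MvPolynomial τ ℂ) :
    approxComplexity (aeval a F) ≤
      (d + 2) ^ 2 * approxComplexity F + (d + 1) + ∑ i, complexity (a i) := by
  refine approxComplexity_le_of_mem ?_
  have h := coeffVec_mem_zariskiClosure_of_rowFinite
    ((aeval a).toLinearMap ∘ₗ ∑ i ∈ Finset.range (d + 1),
      (homogeneousComponent i : MvPolynomial σ ℂ →ₗ[ℂ] MvPolynomial σ ℂ))
    (rowFinite_comp_truncation (aeval a).toLinearMap d)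
    (S := {g : MvPolynomial σ ℂ | complexity g ≤ approxComplexity F})
    (T := {g : MvPolynomial τ ℂ | complexity g ≤
        (d + 2) ^ 2 * approxComplexity F + (d + 1) + ∑ i, complexity (a i)})
    (fun g hg => ?_) (coeffVec_mem_zariskiClosure_approxComplexity F)
  · rw [LinearMap.comp_apply, LinearMap.sum_apply, AlgHom.toLinearMap_apply,
      sum_homogeneousComponent_of_totalDegree_le hF] at h
    exact h
  · rw [LinearMap.comp_apply, LinearMap.sum_apply, AlgHom.toLinearMap_apply]
    calc complexity (aeval a (∑ i ∈ Finset.range (d + 1), homogeneousComponent i g))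
        ≤ complexity (∑ i ∈ Finset.range (d + 1), homogeneousComponent i g) +
            ∑ i, complexity (a i) := complexity_aeval_le _ _
      _ ≤ (d + 2) ^ 2 * complexity g + (d + 1) + ∑ i, complexity (a i) :=
          Nat.add_le_add_right (complexity_sum_homogeneousComponent_le g d) _
      _ ≤ (d + 2) ^ 2 * approxComplexity F + (d + 1) + ∑ i, complexity (a i) := by
          gcongr
          exact hg

/-- **Valiant projections**: if `g` is a projection of `f` (variables ↦ variables or constants) and
`deg f ≤ d`, then `\underline{L}(g) ≤ (d+2)² · \underline{L}(f) + (d+1)` ("if `f` is a projection of `g` then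
clearly `\underline{L}(f) ≤ \underline{L}(g)`", Bürgisser 2004 §4, in the tree's rendering).
[cite: Burgisser2004Factors, §4] [cite: Burgisser2000, Def. 2.6] -/
theorem approxComplexity_le_of_isProjection [Fintype σ] {g : MvPolynomial τ ℂ} {f : MvPolynomial σ ℂ}
    (h : IsProjection g f) {d : ℕ} (hf : f.totalDegree ≤ d) :
    approxComplexity g ≤ (d + 2) ^ 2 * approxComplexity f + (d + 1) := by
  obtain ⟨a, ha, rfl⟩ := h
  have h0 : ∑ i, complexity (a i) = 0 := by
    refine Finset.sum_eq_zero fun i _ => ?_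
    rcases ha i with ⟨j, hj⟩ | ⟨c, hc⟩
    · rw [hj]; exact complexity_X_holds _
    · rw [hc]; exact complexity_C_holds _
  have := approxComplexity_aeval_le hf a
  rw [h0, add_zero] at this
  exact this

/-- **`\overline{VP}` is closed under p-projections (Bürgisser 2004 §4)**, for the tree's
`IsVPBarFamily` (`\underline{L}(f_n)` p-bounded) and a source family of p-bounded degree: if `g` is a
p-projection of `f`, `deg f_n` and `\underline{L}(f_n)` are p-bounded, then `\underline{L}(g_n)` is p-bounded
(`approxComplexity_le_of_isProjection` and closure of p-bounded functions under `+, ·, ∘`).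
[cite: Burgisser2004Factors, §4 (Def. of approximatively p-computable families)] [cite: BurgisserEtAl2011, §9.3] -/
theorem IsVPBarFamily.of_isPProjection {σ τ : ℕ → Type*} [∀ n, Fintype (σ n)]
    [∀ n, DecidableEq (σ n)] [∀ n, Fintype (τ n)] [∀ n, DecidableEq (τ n)]
    {f : ∀ n, MvPolynomial (σ n) ℂ} {g : ∀ n, MvPolynomial (τ n) ℂ}
    (hproj : IsPProjection g f) (hdeg : IsPBounded fun n => (f n).totalDegree)
    (hbar : IsVPBarFamily f) : IsVPBarFamily g := by
  obtain ⟨t, ht, hpr⟩ := hproj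
  have hbound : ∀ n, approxComplexity (g n) ≤
      ((f (t n)).totalDegree + 2) ^ 2 * approxComplexity (f (t n)) + ((f (t n)).totalDegree + 1) :=
    fun n => approxComplexity_le_of_isProjection (hpr n) le_rfl
  refine IsPBounded.mono ?_ hbound
  exact IsPBounded.add_holds
    (IsPBounded.mul_holds
      (IsPBounded.pow_holds (IsPBounded.add_holds (IsPBounded.comp_holds hdeg ht)
        (IsPBounded.const 2)) 2)
      (IsPBounded.comp_holds hbar ht))
    (IsPBounded.add_holds (IsPBounded.comp_holds hdeg ht) (IsPBounded.const 1))

/-- In particular for p-families (Bürgisser 2000 Def. 2.3: p-bounded number of variables and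
degree): a p-projection of a p-family in `\overline{VP}` is in `\overline{VP}`.
[cite: Burgisser2004Factors, §4] [cite: Burgisser2000, Def. 2.3 and 2.6] -/
theorem IsVPBarFamily.of_isPProjection_of_isPFamily {σ τ : ℕ → Type*} [∀ n, Fintype (σ n)]
    [∀ n, DecidableEq (σ n)] [∀ n, Fintype (τ n)] [∀ n, DecidableEq (τ n)]
    {f : ∀ n, MvPolynomial (σ n) ℂ} {g : ∀ n, MvPolynomial (τ n) ℂ}
    (hproj : IsPProjection g f) (hf : IsPFamily f) (hbar : IsVPBarFamily f) : IsVPBarFamily g :=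
  IsVPBarFamily.of_isPProjection hproj hf.2 hbar

/-- `\overline{VP}`-membership is invariant under injective re-indexing of the variables
(`approxComplexity_rename_eq_of_injective`). [cite: Burgisser2004Factors, §4] -/
theorem isVPBarFamily_rename_iff_of_injective {σ τ : ℕ → Type*} [∀ n, Fintype (σ n)]
    [∀ n, DecidableEq (σ n)] [∀ n, Fintype (τ n)] [∀ n, DecidableEq (τ n)]
    {e : ∀ n, σ n → τ n} (he : ∀ n, Function.Injective (e n))
    (f : ∀ n, MvPolynomial (σ n) ℂ) :
    IsVPBarFamily (fun n => rename (e n) (f n)) ↔ IsVPBarFamily f := by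
  unfold IsVPBarFamily
  simp only [approxComplexity_rename_eq_of_injective (he _)]

end ApproxComplexity

end Literature.Computability.AlgebraicComplexity

end
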